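import Literature.Probability.RandomPlanarGeometry.StarHullOneStepClean
import Literature.Probability.RandomPlanarGeometry.SLE
import Literature.Probability.Process.BrownianRunningSup
import HarnessLib

/-!
# [LSW] Prop. 5.2/5.3 at `κ = 8/3`: the one-step conditional drift of `Y = Φ'_{A_t}(W_t)^{5/8}` is `o(h)`

The probabilistic core of the conditional-increment proof of [LSW] Prop. 5.3 (`Y_t` is a martingale
for `κ = 8/3`). Fix a `*`-hull `B₀` in a controlled class (`δ₀ ≤ Φ'_{B₀}(0)`, `B₀` at distance
`≥ 16ρ₀` from `0`, `ρ₀ ≤ 1`) and let it flow for a short time `h` under the SLE_{8/3} driving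
function `U = √(8/3) B` (a fresh Brownian motion: this is the increment driver seen from the base
time, by the Markov property). Then

  `|E[Φ'_{B'}(0)^{5/8}] - Φ'_{B₀}(0)^{5/8}| ≤ C(δ₀, ρ₀) · h √h`     (`abs_integral_rpow_sub_le`)

(`B' = slidHull U B₀ h`), from: the deterministic expansion
`Y' - Y = stepModel(x) + O(uη + u² + |x|³ + u|x|)` on the event `{sup_{[0,h]} |U| ≤ c₀}`
(`StarHullOneStepClean`), whose model term has mean `h · driftCoeff (8/3) d c₂ c₃ = 0`
(`integral_stepModel_eq_zero`: `E x = 0`, `E x² = (8/3) h`, and the drift vanishes at `κ = 8/3`);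
the moments `E|x|³ = O(h^{3/2})`, `E|x| = O(h^{1/2})`, `E η = O(h^{1/2})` (`BrownianRunningSup`);
and the `O(h²)` tail of the running supremum for the bad event, on which `|Y' - Y| ≤ 1`.
Measurability of `ω ↦ Φ'_{B'}(0)` is taken as a hypothesis (it is supplied by the measurability
of the slid-hull functional, `SLERestrictionMeasurable`).

## References

* G. F. Lawler, O. Schramm, W. Werner, *Conformal restriction: the chordal case* (2003),
  Prop. 5.2, Prop. 5.3 [LawlerSchrammWerner2003Restriction].
-/

noncomputable section

open Set Filter Metric Function MeasureTheory
open _root_.Complex _root_.Topology _root_.Real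
open UpperHalfPlane (upperHalfPlaneSet)
open scoped NNReal ENNReal

namespace Literature.Probability.RandomPlanarGeometry

open Literature.Probability.Process Loewner

/-! ### The increment driver `U = √(8/3) B` and the random step data -/

/-- The SLE_{8/3} driving function as the increment driver of one step. [folklore] -/
abbrev stepDriver (ω : ℝ≥0 → ℝ) : ℝ≥0 → ℝ := sleDriving ((8 : ℝ≥0) / 3) ω

/-- `σ = √(8/3)`. [folklore] -/
def stepSigma : ℝ := Real.sqrt (8 / 3)

/-- `σ > 0`. [folklore] -/
theorem stepSigma_pos : 0 < stepSigma := Real.sqrt_pos.2 (by norm_num)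

/-- `σ² = 8/3`. [folklore] -/
theorem stepSigma_sq : stepSigma ^ 2 = 8 / 3 := Real.sq_sqrt (by norm_num)

/-- `σ ≤ 2`. [folklore] -/
theorem stepSigma_le_two : stepSigma ≤ 2 := by
  rw [stepSigma, Real.sqrt_le_left (by norm_num)]; norm_num

/-- `U_r = σ B_r`. [folklore] -/
theorem stepDriver_apply (ω : ℝ≥0 → ℝ) (r : ℝ≥0) : stepDriver ω r = stepSigma * brownian r ω := by
  rw [stepDriver, sleDriving_apply, stepSigma]
  push_cast
  ring_nf

/-- The driver is continuous and starts at `0`. [folklore] -/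
theorem continuous_stepDriver (ω : ℝ≥0 → ℝ) : Continuous (stepDriver ω) ∧ stepDriver ω 0 = 0 :=
  ⟨continuous_sleDriving _ ω, sleDriving_zero _ ω⟩

/-- The oscillation bound `S = σ · runSup h`: `|U_r| ≤ S` for `r ≤ h`. [folklore] -/
theorem abs_stepDriver_le {h r : ℝ≥0} (hr : r ≤ h) (ω : ℝ≥0 → ℝ) :
    |stepDriver ω r| ≤ stepSigma * runSup h ω := by
  rw [stepDriver_apply, abs_mul, abs_of_pos stepSigma_pos]
  exact mul_le_mul_of_nonneg_left (abs_brownian_le_runSup hr ω) stepSigma_pos.le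

/-! ### The model term has mean zero at `κ = 8/3` -/

/-- `E[x] = 0`, `E[x²] = (8/3) h` for `x = U_h = σ B_h`, and integrability of `|x|`, `x²`, `|x|³`, `x⁴`.
[folklore] -/
theorem integral_stepDriver (h : ℝ≥0) :
    (∫ ω, stepDriver ω h ∂preWienerMeasure = 0) ∧
    (∫ ω, stepDriver ω h ^ 2 ∂preWienerMeasure = 8 / 3 * h) ∧
    Integrable (fun ω ↦ stepDriver ω h) preWienerMeasure ∧
    Integrable (fun ω ↦ stepDriver ω h ^ 2) preWienerMeasure ∧
    Integrable (fun ω ↦ |stepDriver ω h| ^ 3) preWienerMeasure ∧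
    Integrable (fun ω ↦ stepDriver ω h ^ 4) preWienerMeasure := by
  have hfun : (fun ω ↦ stepDriver ω h) = fun ω ↦ stepSigma * brownian h ω := funext fun ω ↦ stepDriver_apply ω h
  refine ⟨?_, ?_, ?_, ?_, ?_, ?_⟩
  · rw [hfun, integral_const_mul, integral_brownian_eq_zero, mul_zero]
  · simp_rw [stepDriver_apply, mul_pow]
    rw [integral_const_mul, integral_brownian_sq, stepSigma_sq]
  · rw [hfun]; exact (integrable_brownian_pow h 1).const_mul stepSigma |>.congr (Eventually.of_forall fun ω ↦ by simp)
  · simp_rw [stepDriver_apply, mul_pow]; exact (integrable_brownian_pow h 2).const_mul _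
  · simp_rw [stepDriver_apply, abs_mul, mul_pow]; exact (integrable_abs_brownian_pow h 3).const_mul _
  · simp_rw [stepDriver_apply, mul_pow]; exact (integrable_brownian_pow h 4).const_mul _

/-- **`E[stepModel d c₂ c₃ h x] = h · driftCoeff (8/3) d c₂ c₃ = 0`**: the linear term has mean zero,
the quadratic term has mean `(8/3) h`, and the drift coefficient vanishes at `κ = 8/3`.
[cite: LawlerSchrammWerner2003Restriction, Prop. 5.2] -/
theorem integral_stepModel_eq_zero {d : ℝ} (hd : 0 < d) (c₂ c₃ : ℝ) (h : ℝ≥0) :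
    ∫ ω, stepModel d c₂ c₃ h (stepDriver ω h) ∂preWienerMeasure = 0 ∧
      Integrable (fun ω ↦ stepModel d c₂ c₃ h (stepDriver ω h)) preWienerMeasure := by
  haveI := isProbabilityMeasure_preWienerMeasure'
  obtain ⟨h1, h2, i1, i2, -, -⟩ := integral_stepDriver h
  have hfun : (fun ω ↦ stepModel d c₂ c₃ h (stepDriver ω h)) = fun ω ↦
      5 / 8 * d ^ (-(3 / 8 : ℝ)) * c₂ * stepDriver ω h +
        (5 / 8 * d ^ (-(3 / 8 : ℝ)) * (c₃ / 2) + 1 / 2 * (-(15 / 64) * d ^ (-(11 / 8 : ℝ))) * c₂ ^ 2) *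
          (stepDriver ω h ^ 2 - 8 / 3 * h) + h * driftCoeff (8 / 3) d c₂ c₃ := funext fun ω ↦ stepModel_eq _ _ _ _ _ _
  have iA : Integrable (fun ω ↦ 5 / 8 * d ^ (-(3 / 8 : ℝ)) * c₂ * stepDriver ω h) preWienerMeasure := i1.const_mul _
  have iB : Integrable (fun ω ↦ (5 / 8 * d ^ (-(3 / 8 : ℝ)) * (c₃ / 2) + 1 / 2 * (-(15 / 64) * d ^ (-(11 / 8 : ℝ))) * c₂ ^ 2) *
      (stepDriver ω h ^ 2 - 8 / 3 * h)) preWienerMeasure := (i2.sub (integrable_const _)).const_mul _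
  have iAB : Integrable (fun ω ↦ 5 / 8 * d ^ (-(3 / 8 : ℝ)) * c₂ * stepDriver ω h +
      (5 / 8 * d ^ (-(3 / 8 : ℝ)) * (c₃ / 2) + 1 / 2 * (-(15 / 64) * d ^ (-(11 / 8 : ℝ))) * c₂ ^ 2) *
        (stepDriver ω h ^ 2 - 8 / 3 * h)) preWienerMeasure := iA.add iB
  refine ⟨?_, by rw [hfun]; exact iAB.add (integrable_const _)⟩
  rw [hfun, integral_add iAB (integrable_const _), integral_add iA iB, integral_const_mul, h1,
    integral_const_mul, integral_sub i2 (integrable_const _), h2, integral_const, integral_const,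
    driftCoeff_eight_thirds hd]
  simp

/-! ### `Φ'_B(0) ∈ (0, 1]` for every set -/

/-- `0 < starDeriv B ≤ 1` for EVERY set (junk value `1` off `𝒬*`), so `Y = starDeriv^{5/8} ∈ (0, 1]`.
[folklore] -/
theorem starDeriv_pos_le_one (B : Set ℂ) : 0 < starDeriv B ∧ starDeriv B ≤ 1 := by
  by_cases h : IsStarHull B
  · exact ⟨(starDeriv_spec h).1, (starDeriv_spec h).2.1⟩
  · rw [starDeriv, dif_neg h]; exact ⟨one_pos, le_rfl⟩

/-- `|Y' - Y| ≤ 1` for `Y, Y' ∈ [0, 1]`. [folklore] -/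
theorem abs_rpow_starDeriv_sub_le (B B' : Set ℂ) :
    |starDeriv B' ^ (5 / 8 : ℝ) - starDeriv B ^ (5 / 8 : ℝ)| ≤ 1 := by
  obtain ⟨h0, h1⟩ := starDeriv_pos_le_one B
  obtain ⟨h0', h1'⟩ := starDeriv_pos_le_one B'
  have e1 : starDeriv B ^ (5 / 8 : ℝ) ≤ 1 := Real.rpow_le_one h0.le h1 (by norm_num)
  have e2 : starDeriv B' ^ (5 / 8 : ℝ) ≤ 1 := Real.rpow_le_one h0'.le h1' (by norm_num)
  have e3 : 0 ≤ starDeriv B ^ (5 / 8 : ℝ) := Real.rpow_nonneg h0.le _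
  have e4 : 0 ≤ starDeriv B' ^ (5 / 8 : ℝ) := Real.rpow_nonneg h0'.le _
  rw [abs_le]; constructor <;> linarith

/-! ### The random one-step error and the good event -/

/-- **The one-step error** `F(ω) = Y'(ω) - Y - stepModel(x(ω))`, with `Y' = Φ'_{B'}(0)^{5/8}`,
`B' = slidHull (√(8/3)B(ω)) B₀ h`, `Y = Φ'_{B₀}(0)^{5/8}`, `x = √(8/3) B_h`. [folklore] -/
def stepErrFn (B₀ : Set ℂ) (h : ℝ≥0) (ω : ℝ≥0 → ℝ) : ℝ :=
  starDeriv (slidHull (stepDriver ω) B₀ h) ^ (5 / 8 : ℝ) - starDeriv B₀ ^ (5 / 8 : ℝ) -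
    stepModel (starDeriv B₀) (starJet2 B₀) (starJet3 B₀) h (stepDriver ω h)

/-- **The good event** `{σ · sup_{[0,h]} |B| ≤ c₀}`, `c₀ = δ₀ρ₀/4000`. [folklore] -/
def goodEvent (δ₀ ρ₀ : ℝ) (h : ℝ≥0) : Set (ℝ≥0 → ℝ) := {ω | stepSigma * runSup h ω ≤ δ₀ * ρ₀ / 4000}

/-- The good event is measurable. [folklore] -/
theorem measurableSet_goodEvent (δ₀ ρ₀ : ℝ) (h : ℝ≥0) : MeasurableSet (goodEvent δ₀ ρ₀ h) :=
  measurableSet_le ((measurable_runSup h).const_mul _) measurable_const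

/-- **The coefficient bounds for the model**: `A₁ = (5/8) δ₀^{-3/8}/ρ₀`. [folklore] -/
def stepA1 (δ₀ ρ₀ : ℝ) : ℝ := 5 / 8 * δ₀ ^ (-(3 / 8 : ℝ)) * (1 / ρ₀)

/-- `A₂ = ((5/8)δ₀^{-3/8} + (15/128)δ₀^{-11/8})/ρ₀²`. [folklore] -/
def stepA2 (δ₀ ρ₀ : ℝ) : ℝ := (5 / 8 * δ₀ ^ (-(3 / 8 : ℝ)) + 15 / 128 * δ₀ ^ (-(11 / 8 : ℝ))) * (1 / ρ₀ ^ 2)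

/-- The constant of the one-step estimate. [folklore] -/
def stepC (δ₀ ρ₀ : ℝ) : ℝ :=
  25 * stepKcleanOf δ₀ (stepK δ₀ ρ₀) +
    (2048 / (δ₀ * ρ₀ / 4000) ^ 4 * (1 + 3 * stepA2 δ₀ ρ₀) +
      2 * stepA1 δ₀ ρ₀ * Real.sqrt (2048 / (δ₀ * ρ₀ / 4000) ^ 4) +
      5 * stepA2 δ₀ ρ₀ * Real.sqrt (2048 / (δ₀ * ρ₀ / 4000) ^ 4))

/-! ### Pointwise bounds: the good event and the bad event -/

section Estimates

variable {B₀ : Set ℂ} {ρ₀ δ₀ : ℝ} {h : ℝ≥0}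
variable (hB : IsStarHull B₀) (hρ₀ : 0 < ρ₀) (hρ1 : ρ₀ ≤ 1) (hBρ : Disjoint (ball (0 : ℂ) (8 * ρ₀)) B₀)
  (hδ0 : 0 < δ₀) (hδ : δ₀ ≤ starDeriv B₀) (hh0 : 0 < h) (hh : (h : ℝ) ≤ (δ₀ * ρ₀ / 4000) ^ 2 / 32)

include hB hρ₀ hρ1 hδ0 hδ hh in
/-- Elementary consequences of the smallness of `h`: with `c₀ = δ₀ρ₀/4000`, `4√h ≤ c₀`, `h ≤ 1`,
`c₀ ≤ 1/4000`, `h² ≤ h√h`, `h ≤ √h`. [folklore] -/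
theorem step_smallness : 0 < δ₀ * ρ₀ / 4000 ∧ δ₀ * ρ₀ / 4000 ≤ 1 / 4000 ∧
    4 * Real.sqrt h ≤ δ₀ * ρ₀ / 4000 ∧ (h : ℝ) ≤ 1 ∧ (h : ℝ) ^ 2 ≤ h * Real.sqrt h ∧ (h : ℝ) ≤ Real.sqrt h := by
  obtain ⟨hd0, hd1, -⟩ := starDeriv_spec hB
  have hδ1 : δ₀ ≤ 1 := hδ.trans hd1
  have hc0 : 0 < δ₀ * ρ₀ / 4000 := by positivity
  have hc1 : δ₀ * ρ₀ / 4000 ≤ 1 / 4000 := by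
    rw [div_le_div_iff_of_pos_right (by norm_num)]
    have := mul_le_mul hδ1 hρ1 hρ₀.le zero_le_one
    linarith
  have hh16 : (h : ℝ) ≤ (δ₀ * ρ₀ / 4000 / 4) ^ 2 := by nlinarith
  have hsqrt : Real.sqrt h ≤ δ₀ * ρ₀ / 4000 / 4 := by
    rw [Real.sqrt_le_left (by positivity)]; exact hh16
  have hh1 : (h : ℝ) ≤ 1 := by nlinarith
  have hhs : (h : ℝ) ≤ Real.sqrt h := by
    rw [Real.le_sqrt h.coe_nonneg h.coe_nonneg]; nlinarith [h.coe_nonneg]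
  refine ⟨hc0, hc1, by linarith, hh1, ?_, hhs⟩
  nlinarith [h.coe_nonneg]

include hB hρ₀ hρ1 hBρ hδ0 hδ hh0 hh in
/-- **On the good event** the clean one-step bound applies:
`|F| ≤ K_clean (h η + h² + |x|³ + h|x|)`, `η = σ runSup h + 4√h ≤ 2c₀`.
[cite: LawlerSchrammWerner2003Restriction, Prop. 5.2 (5.3)] -/
theorem abs_stepErrFn_le_of_good {ω : ℝ≥0 → ℝ} (hω : ω ∈ goodEvent δ₀ ρ₀ h) :
    |stepErrFn B₀ h ω| ≤ stepKcleanOf δ₀ (stepK δ₀ ρ₀) *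
        (h * stepSize (stepSigma * runSup h ω) h + h ^ 2 + |stepDriver ω h| ^ 3 + h * |stepDriver ω h|) := by
  obtain ⟨hc0, hc1, h4, hh1, -⟩ := step_smallness hB hρ₀ hρ1 hδ0 hδ hh
  obtain ⟨hUc, hU0⟩ := continuous_stepDriver ω
  have hω' : stepSigma * runSup h ω ≤ δ₀ * ρ₀ / 4000 := hω
  have hS : ∀ v : ℝ≥0, v ≤ h → |stepDriver ω v| ≤ stepSigma * runSup h ω := fun v hv ↦ abs_stepDriver_le hv ω
  have hη2 : stepSize (stepSigma * runSup h ω) h ≤ 2 * (δ₀ * ρ₀ / 4000) := by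
    rw [stepSize]; linarith
  have hη : stepSize (stepSigma * runSup h ω) h ≤ starDeriv B₀ * ρ₀ / 1000 := by
    refine hη2.trans ?_
    rw [show 2 * (δ₀ * ρ₀ / 4000) = δ₀ * ρ₀ / 2000 by ring, div_le_div_iff₀ (by norm_num) (by norm_num)]
    nlinarith [mul_le_mul_of_nonneg_right hδ hρ₀.le]
  have hη1 : stepSize (stepSigma * runSup h ω) h ≤ 1 := by linarith
  exact abs_rpow_sub_stepModel_le_clean hB hUc hU0 hh0 hS hρ₀ hBρ hη hρ1 hδ0 hδ hη1 hh1

include hB hρ₀ hBρ hδ0 hδ in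
/-- **The model term is at most quadratic**: `|stepModel d c₂ c₃ h x| ≤ A₁ |x| + A₂ (x² + (8/3) h)`
(the drift term vanishes at `κ = 8/3`; `|c₂| ≤ 1/ρ₀`, `|c₃| ≤ 2/ρ₀²`, `d ≥ δ₀`). [folklore] -/
theorem abs_stepModel_le (x : ℝ) :
    |stepModel (starDeriv B₀) (starJet2 B₀) (starJet3 B₀) h x| ≤
      stepA1 δ₀ ρ₀ * |x| + stepA2 δ₀ ρ₀ * (x ^ 2 + 8 / 3 * h) := by
  obtain ⟨hd0, hd1, -⟩ := starDeriv_spec hB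
  obtain ⟨-, -, hc2, hc3, -⟩ := starJet_spec hB hρ₀ hBρ
  have hT2 : starDeriv B₀ ^ (-(3 / 8 : ℝ)) ≤ δ₀ ^ (-(3 / 8 : ℝ)) := Real.rpow_le_rpow_of_nonpos hδ0 hδ (by norm_num)
  have hT3 : starDeriv B₀ ^ (-(11 / 8 : ℝ)) ≤ δ₀ ^ (-(11 / 8 : ℝ)) := Real.rpow_le_rpow_of_nonpos hδ0 hδ (by norm_num)
  have hd38 : 0 ≤ starDeriv B₀ ^ (-(3 / 8 : ℝ)) := Real.rpow_nonneg hd0.le _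
  have hd118 : 0 ≤ starDeriv B₀ ^ (-(11 / 8 : ℝ)) := Real.rpow_nonneg hd0.le _
  have hδ38 : 0 ≤ δ₀ ^ (-(3 / 8 : ℝ)) := Real.rpow_nonneg hδ0.le _
  have hδ118 : 0 ≤ δ₀ ^ (-(11 / 8 : ℝ)) := Real.rpow_nonneg hδ0.le _
  rw [stepModel_eq _ _ _ _ _ (8 / 3), driftCoeff_eight_thirds hd0, mul_zero, add_zero]
  have hρinv : 0 ≤ 1 / ρ₀ := by positivity
  have hρinv2 : 0 ≤ 1 / ρ₀ ^ 2 := by positivity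
  have e1 : |5 / 8 * starDeriv B₀ ^ (-(3 / 8 : ℝ)) * starJet2 B₀ * x| ≤ stepA1 δ₀ ρ₀ * |x| := by
    rw [abs_mul, stepA1]
    refine mul_le_mul_of_nonneg_right ?_ (abs_nonneg _)
    rw [abs_mul, abs_of_nonneg (by positivity : (0:ℝ) ≤ 5 / 8 * starDeriv B₀ ^ (-(3 / 8 : ℝ)))]
    exact mul_le_mul (mul_le_mul_of_nonneg_left hT2 (by norm_num)) hc2 (abs_nonneg _) (by positivity)
  have e2 : |(5 / 8 * starDeriv B₀ ^ (-(3 / 8 : ℝ)) * (starJet3 B₀ / 2) +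
      1 / 2 * (-(15 / 64) * starDeriv B₀ ^ (-(11 / 8 : ℝ))) * starJet2 B₀ ^ 2) * (x ^ 2 - 8 / 3 * h)| ≤
      stepA2 δ₀ ρ₀ * (x ^ 2 + 8 / 3 * h) := by
    rw [abs_mul]
    have hx : |x ^ 2 - 8 / 3 * h| ≤ x ^ 2 + 8 / 3 * h := by
      rw [abs_le]; constructor <;> nlinarith [sq_nonneg x, h.coe_nonneg]
    refine mul_le_mul ?_ hx (abs_nonneg _) (by rw [stepA2]; positivity)
    have f1 : |5 / 8 * starDeriv B₀ ^ (-(3 / 8 : ℝ)) * (starJet3 B₀ / 2)| ≤ 5 / 8 * δ₀ ^ (-(3 / 8 : ℝ)) * (1 / ρ₀ ^ 2) := by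
      rw [abs_mul, abs_of_nonneg (by positivity : (0:ℝ) ≤ 5 / 8 * starDeriv B₀ ^ (-(3 / 8 : ℝ)))]
      have : |starJet3 B₀ / 2| ≤ 1 / ρ₀ ^ 2 := by
        rw [abs_div, abs_two, div_le_iff₀ (by norm_num : (0:ℝ) < 2)]
        calc |starJet3 B₀| ≤ 2 / ρ₀ ^ 2 := hc3
          _ = 1 / ρ₀ ^ 2 * 2 := by ring
      exact mul_le_mul (mul_le_mul_of_nonneg_left hT2 (by norm_num)) this (abs_nonneg _) (by positivity)
    have f2 : |1 / 2 * (-(15 / 64) * starDeriv B₀ ^ (-(11 / 8 : ℝ))) * starJet2 B₀ ^ 2| ≤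
        15 / 128 * δ₀ ^ (-(11 / 8 : ℝ)) * (1 / ρ₀ ^ 2) := by
      rw [show 1 / 2 * (-(15 / 64) * starDeriv B₀ ^ (-(11 / 8 : ℝ))) * starJet2 B₀ ^ 2 =
        -(15 / 128 * starDeriv B₀ ^ (-(11 / 8 : ℝ)) * starJet2 B₀ ^ 2) by ring, abs_neg,
        abs_of_nonneg (by positivity)]
      have hc2' : starJet2 B₀ ^ 2 ≤ 1 / ρ₀ ^ 2 := by
        have := pow_le_pow_left₀ (abs_nonneg _) hc2 2
        rw [sq_abs] at this
        rw [show 1 / ρ₀ ^ 2 = (1 / ρ₀) ^ 2 by ring]; exact this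
      exact mul_le_mul (mul_le_mul_of_nonneg_left hT3 (by norm_num)) hc2' (sq_nonneg _) (by positivity)
    calc _ ≤ |5 / 8 * starDeriv B₀ ^ (-(3 / 8 : ℝ)) * (starJet3 B₀ / 2)| +
          |1 / 2 * (-(15 / 64) * starDeriv B₀ ^ (-(11 / 8 : ℝ))) * starJet2 B₀ ^ 2| := abs_add_le _ _
      _ ≤ 5 / 8 * δ₀ ^ (-(3 / 8 : ℝ)) * (1 / ρ₀ ^ 2) + 15 / 128 * δ₀ ^ (-(11 / 8 : ℝ)) * (1 / ρ₀ ^ 2) := add_le_add f1 f2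
      _ = stepA2 δ₀ ρ₀ := by rw [stepA2]; ring
  exact (abs_add_le _ _).trans (add_le_add e1 e2)

include hB hρ₀ hBρ hδ0 hδ in
/-- **On the bad event** (in fact everywhere): `|F| ≤ 1 + A₁|x| + A₂(x² + (8/3)h)`. [folklore] -/
theorem abs_stepErrFn_le (ω : ℝ≥0 → ℝ) :
    |stepErrFn B₀ h ω| ≤ 1 + stepA1 δ₀ ρ₀ * |stepDriver ω h| + stepA2 δ₀ ρ₀ * (stepDriver ω h ^ 2 + 8 / 3 * h) := by
  rw [stepErrFn]
  have h1 := abs_sub (starDeriv (slidHull (stepDriver ω) B₀ h) ^ (5 / 8 : ℝ) - starDeriv B₀ ^ (5 / 8 : ℝ))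
    (stepModel (starDeriv B₀) (starJet2 B₀) (starJet3 B₀) h (stepDriver ω h))
  have h2 := abs_rpow_starDeriv_sub_le B₀ (slidHull (stepDriver ω) B₀ h)
  have h3 := abs_stepModel_le hB hρ₀ hBρ hδ0 hδ (h := h) (stepDriver ω h)
  linarith

/-! ### Integrability and the three integral estimates -/

/-- Measurability and integrability of the pieces, given measurability of `ω ↦ Φ'_{B'}(0)`.
[folklore] -/
theorem integrable_stepErrFn (hmeas : Measurable fun ω ↦ starDeriv (slidHull (stepDriver ω) B₀ h)) :
    Integrable (fun ω ↦ starDeriv (slidHull (stepDriver ω) B₀ h) ^ (5 / 8 : ℝ)) preWienerMeasure ∧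
      Integrable (stepErrFn B₀ h) preWienerMeasure := by
  haveI := isProbabilityMeasure_preWienerMeasure'
  obtain ⟨d0, -⟩ := starDeriv_pos_le_one B₀
  have hY'm : Measurable fun ω ↦ starDeriv (slidHull (stepDriver ω) B₀ h) ^ (5 / 8 : ℝ) := hmeas.pow_const _
  have iY' : Integrable (fun ω ↦ starDeriv (slidHull (stepDriver ω) B₀ h) ^ (5 / 8 : ℝ)) preWienerMeasure :=
    (integrable_const (1 : ℝ)).mono' hY'm.aestronglyMeasurable (Eventually.of_forall fun ω ↦ by
      obtain ⟨p0, p1⟩ := starDeriv_pos_le_one (slidHull (stepDriver ω) B₀ h)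
      rw [Real.norm_eq_abs, abs_of_nonneg (Real.rpow_nonneg p0.le _)]
      exact Real.rpow_le_one p0.le p1 (by norm_num))
  obtain ⟨-, iM⟩ := integral_stepModel_eq_zero d0 (starJet2 B₀) (starJet3 B₀) h
  exact ⟨iY', (iY'.sub (integrable_const _)).sub iM⟩

include hB hρ₀ hρ1 hBρ hδ0 hδ hh0 hh in
/-- **The good-event integral**: `∫_G |F| ≤ 25 K_clean h √h`. [folklore] -/
theorem setIntegral_good_le (hmeas : Measurable fun ω ↦ starDeriv (slidHull (stepDriver ω) B₀ h)) :
    ∫ ω in goodEvent δ₀ ρ₀ h, |stepErrFn B₀ h ω| ∂preWienerMeasure ≤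
      25 * stepKcleanOf δ₀ (stepK δ₀ ρ₀) * h * Real.sqrt h := by
  haveI := isProbabilityMeasure_preWienerMeasure'
  obtain ⟨hc0, hc1, h4, hh1, hh2, hhs⟩ := step_smallness hB hρ₀ hρ1 hδ0 hδ hh
  obtain ⟨hd0, hd1, -⟩ := starDeriv_spec hB
  obtain ⟨-, iF⟩ := integrable_stepErrFn (B₀ := B₀) (h := h) hmeas
  obtain ⟨-, -, i1, -, i3, -⟩ := integral_stepDriver h
  set Kc := stepKcleanOf δ₀ (stepK δ₀ ρ₀) with hKc
  have hKc0 : 0 ≤ Kc := by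
    rw [hKc, stepKcleanOf]; have := (stepK_spec hδ0 (hδ.trans hd1) hρ₀ hρ1).1; positivity
  have hh0' : (0 : ℝ) ≤ h := h.coe_nonneg
  -- the dominating function and its integral
  have iη : Integrable (fun ω ↦ stepSize (stepSigma * runSup h ω) h) preWienerMeasure := by
    have : (fun ω ↦ stepSize (stepSigma * runSup h ω) h) = fun ω ↦ stepSigma * runSup h ω + 4 * Real.sqrt h := by
      funext ω; rw [stepSize]
    rw [this]; exact ((integrable_runSup h).const_mul _).add (integrable_const _)
  have iA : Integrable (fun ω ↦ h * stepSize (stepSigma * runSup h ω) h + h ^ 2) preWienerMeasure :=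
    (iη.const_mul _).add (integrable_const _)
  have iAB : Integrable (fun ω ↦ h * stepSize (stepSigma * runSup h ω) h + h ^ 2 + |stepDriver ω h| ^ 3) preWienerMeasure :=
    iA.add i3
  have iD : Integrable (fun ω ↦ h * |stepDriver ω h|) preWienerMeasure := i1.abs.const_mul _
  have iABD : Integrable (fun ω ↦ h * stepSize (stepSigma * runSup h ω) h + h ^ 2 + |stepDriver ω h| ^ 3 + h * |stepDriver ω h|)
      preWienerMeasure := iAB.add iD
  have ibound : Integrable (fun ω ↦ Kc * (h * stepSize (stepSigma * runSup h ω) h + h ^ 2 + |stepDriver ω h| ^ 3 +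
      h * |stepDriver ω h|)) preWienerMeasure := iABD.const_mul Kc
  have hpos : ∀ ω, 0 ≤ Kc * (h * stepSize (stepSigma * runSup h ω) h + h ^ 2 + |stepDriver ω h| ^ 3 + h * |stepDriver ω h|) := by
    intro ω
    have : 0 ≤ stepSize (stepSigma * runSup h ω) h := by
      rw [stepSize]; have := runSup_nonneg h ω; have := stepSigma_pos; positivity
    positivity
  -- the three moment bounds
  have e1 : ∫ ω, stepSize (stepSigma * runSup h ω) h ∂preWienerMeasure ≤ 8 * Real.sqrt h := by
    have : (fun ω ↦ stepSize (stepSigma * runSup h ω) h) = fun ω ↦ stepSigma * runSup h ω + 4 * Real.sqrt h := by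
      funext ω; rw [stepSize]
    rw [this, integral_add ((integrable_runSup h).const_mul _) (integrable_const _), integral_const_mul, integral_const]
    simp only [probReal_univ, smul_eq_mul, one_mul]
    have h1 := integral_runSup_le h
    have h2 := mul_le_mul_of_nonneg_left h1 stepSigma_pos.le
    nlinarith [stepSigma_le_two, Real.sqrt_nonneg (h : ℝ)]
  have e2 : ∫ ω, |stepDriver ω h| ^ 3 ∂preWienerMeasure ≤ 14 * h * Real.sqrt h := by
    have : (fun ω ↦ |stepDriver ω h| ^ 3) = fun ω ↦ stepSigma ^ 3 * |brownian h ω| ^ 3 := by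
      funext ω; rw [stepDriver_apply, abs_mul, mul_pow, abs_of_pos stepSigma_pos]
    rw [this, integral_const_mul]
    have h3 := integral_abs_brownian_pow_three_le h
    have hσ3 : stepSigma ^ 3 ≤ 8 := by
      have := pow_le_pow_left₀ stepSigma_pos.le stepSigma_le_two 3; norm_num at this; exact this
    have hs3 : Real.sqrt 3 ≤ 7 / 4 := by rw [Real.sqrt_le_left (by norm_num)]; norm_num
    have hh32 : (h : ℝ) ^ (3 / 2 : ℝ) = h * Real.sqrt h := by
      rw [show (3 / 2 : ℝ) = 1 + 1 / 2 by norm_num, Real.rpow_add' hh0' (by norm_num), Real.rpow_one, Real.sqrt_eq_rpow]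
    rw [hh32] at h3
    have hI0 : 0 ≤ ∫ ω, |brownian h ω| ^ 3 ∂preWienerMeasure := integral_nonneg fun ω ↦ by positivity
    have hm : 0 ≤ (h : ℝ) * Real.sqrt h := by positivity
    calc stepSigma ^ 3 * ∫ ω, |brownian h ω| ^ 3 ∂preWienerMeasure ≤ 8 * (Real.sqrt 3 * (h * Real.sqrt h)) :=
          mul_le_mul hσ3 h3 hI0 (by norm_num)
      _ ≤ 14 * h * Real.sqrt h := by nlinarith
  have e3 : ∫ ω, |stepDriver ω h| ∂preWienerMeasure ≤ 2 * Real.sqrt h := by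
    have : (fun ω ↦ |stepDriver ω h|) = fun ω ↦ stepSigma * |brownian h ω| := by
      funext ω; rw [stepDriver_apply, abs_mul, abs_of_pos stepSigma_pos]
    rw [this, integral_const_mul]
    have h1 := integral_abs_brownian_le h
    have h2 := mul_le_mul_of_nonneg_left h1 stepSigma_pos.le
    nlinarith [stepSigma_le_two, Real.sqrt_nonneg (h : ℝ)]
  -- the integral of the dominating function
  have hint : ∫ ω, Kc * (h * stepSize (stepSigma * runSup h ω) h + h ^ 2 + |stepDriver ω h| ^ 3 + h * |stepDriver ω h|)
      ∂preWienerMeasure ≤ 25 * Kc * h * Real.sqrt h := by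
    rw [integral_const_mul, integral_add iAB iD, integral_add iA i3, integral_add (iη.const_mul _) (integrable_const _),
      integral_const_mul, integral_const_mul, integral_const]
    simp only [probReal_univ, smul_eq_mul, one_mul]
    have f1 := mul_le_mul_of_nonneg_left e1 hh0'
    have f3 := mul_le_mul_of_nonneg_left e3 hh0'
    have hsum : (h : ℝ) * ∫ ω, stepSize (stepSigma * runSup h ω) h ∂preWienerMeasure + (h : ℝ) ^ 2 +
        ∫ ω, |stepDriver ω h| ^ 3 ∂preWienerMeasure + (h : ℝ) * ∫ ω, |stepDriver ω h| ∂preWienerMeasure ≤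
        25 * h * Real.sqrt h := by nlinarith
    have := mul_le_mul_of_nonneg_left hsum hKc0
    nlinarith [this]
  -- monotonicity
  calc ∫ ω in goodEvent δ₀ ρ₀ h, |stepErrFn B₀ h ω| ∂preWienerMeasure
      ≤ ∫ ω in goodEvent δ₀ ρ₀ h, Kc * (h * stepSize (stepSigma * runSup h ω) h + h ^ 2 + |stepDriver ω h| ^ 3 +
          h * |stepDriver ω h|) ∂preWienerMeasure :=
        setIntegral_mono_on iF.abs.integrableOn ibound.integrableOn (measurableSet_goodEvent δ₀ ρ₀ h)
          fun ω hω ↦ abs_stepErrFn_le_of_good hB hρ₀ hρ1 hBρ hδ0 hδ hh0 hh hω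
    _ ≤ ∫ ω, Kc * (h * stepSize (stepSigma * runSup h ω) h + h ^ 2 + |stepDriver ω h| ^ 3 + h * |stepDriver ω h|)
          ∂preWienerMeasure := setIntegral_le_integral ibound (Eventually.of_forall hpos)
    _ ≤ 25 * Kc * h * Real.sqrt h := hint

/-- **Cauchy–Schwarz against an event**: for `g ≥ 0` in `L²` and a measurable set `s`,
`∫_s g ≤ √(P(s)) · √(∫ g²)`. [folklore] -/
theorem setIntegral_le_sqrt_mul_sqrt {s : Set (ℝ≥0 → ℝ)} (hs : MeasurableSet s) {g : (ℝ≥0 → ℝ) → ℝ}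
    (hg0 : ∀ ω, 0 ≤ g ω) (hg : MemLp g 2 preWienerMeasure) :
    ∫ ω in s, g ω ∂preWienerMeasure ≤
      Real.sqrt (preWienerMeasure.real s) * Real.sqrt (∫ ω, g ω ^ 2 ∂preWienerMeasure) := by
  haveI := isProbabilityMeasure_preWienerMeasure'
  have hH := integral_mul_le_Lp_mul_Lq_of_nonneg (μ := preWienerMeasure) Real.HolderConjugate.two_two
    (f := s.indicator fun _ ↦ (1 : ℝ)) (g := g)
    (Eventually.of_forall fun ω ↦ Set.indicator_nonneg (fun _ _ ↦ zero_le_one) ω)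
    (Eventually.of_forall hg0)
    (by rw [ENNReal.ofReal_ofNat]; exact (memLp_const (1 : ℝ)).indicator hs)
    (by rw [ENNReal.ofReal_ofNat]; exact hg)
  have hlhs : ∫ ω, s.indicator (fun _ ↦ (1 : ℝ)) ω * g ω ∂preWienerMeasure = ∫ ω in s, g ω ∂preWienerMeasure := by
    rw [← integral_indicator hs]
    congr 1; funext ω
    by_cases hω : ω ∈ s <;> simp [hω]
  have hind : ∫ ω, s.indicator (fun _ ↦ (1 : ℝ)) ω ^ (2 : ℝ) ∂preWienerMeasure = preWienerMeasure.real s := by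
    have : (fun ω ↦ s.indicator (fun _ ↦ (1 : ℝ)) ω ^ (2 : ℝ)) = s.indicator fun _ ↦ (1 : ℝ) := by
      funext ω; by_cases hω : ω ∈ s <;> simp [hω]
    rw [this, integral_indicator_const (1 : ℝ) hs, smul_eq_mul, mul_one]
  have hg2 : ∫ ω, g ω ^ (2 : ℝ) ∂preWienerMeasure = ∫ ω, g ω ^ 2 ∂preWienerMeasure := by
    congr 1; funext ω; rw [show (2 : ℝ) = (2 : ℕ) by norm_num, Real.rpow_natCast]
  rw [hlhs, hind, hg2] at hH
  rw [Real.sqrt_eq_rpow, Real.sqrt_eq_rpow]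
  convert hH using 3

include hB hρ₀ hρ1 hδ0 hδ hh0 hh in
/-- **Tail of the bad event**: `P(σ runSup h > c₀) ≤ (2048/c₀⁴) h²`. [folklore] -/
theorem measureReal_bad_le :
    preWienerMeasure.real (goodEvent δ₀ ρ₀ h)ᶜ ≤ 2048 / (δ₀ * ρ₀ / 4000) ^ 4 * (h : ℝ) ^ 2 := by
  haveI := isProbabilityMeasure_preWienerMeasure'
  obtain ⟨hc0, hc1, h4, hh1, -⟩ := step_smallness hB hρ₀ hρ1 hδ0 hδ hh
  set c₀ := δ₀ * ρ₀ / 4000 with hc₀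
  set a : ℝ := c₀ / stepSigma with ha
  have hσ := stepSigma_pos
  have hσ2 := stepSigma_le_two
  have ha0 : 0 < a := by positivity
  have hac : c₀ / 2 ≤ a := by rw [ha]; exact div_le_div_of_nonneg_left hc0.le hσ hσ2
  have ha2 : 2 * (h : ℝ) ≤ (a / 2) ^ 2 := by nlinarith
  have hhpos : (0 : ℝ) < h := hh0
  have hlt : (h : ℝ) < (a / 2) ^ 2 := by linarith
  have hsub : (goodEvent δ₀ ρ₀ h)ᶜ ⊆ {ω | a ≤ runSup h ω} := fun ω hω ↦ by
    have : ¬ stepSigma * runSup h ω ≤ c₀ := hω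
    show c₀ / stepSigma ≤ runSup h ω
    rw [div_le_iff₀ hσ]; linarith [not_le.1 this]
  have h1 := (measure_mono hsub).trans (measure_runSup_ge_le h ha0.le hlt)
  have hbound : 2 * (h : ℝ) ^ 2 / ((a / 2) ^ 2 - h) ^ 2 ≤ 2048 / c₀ ^ 4 * (h : ℝ) ^ 2 := by
    have hden : (a / 2) ^ 2 / 2 ≤ (a / 2) ^ 2 - h := by linarith
    have hden0 : 0 < (a / 2) ^ 2 / 2 := by positivity
    calc 2 * (h : ℝ) ^ 2 / ((a / 2) ^ 2 - h) ^ 2 ≤ 2 * (h : ℝ) ^ 2 / ((a / 2) ^ 2 / 2) ^ 2 := by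
          gcongr
      _ = 128 * (h : ℝ) ^ 2 / a ^ 4 := by field_simp; ring
      _ ≤ 128 * (h : ℝ) ^ 2 / (c₀ / 2) ^ 4 := by gcongr
      _ = 2048 / c₀ ^ 4 * (h : ℝ) ^ 2 := by field_simp; ring
  rw [measureReal_def]
  calc (preWienerMeasure (goodEvent δ₀ ρ₀ h)ᶜ).toReal
      ≤ (ENNReal.ofReal (2 * (h : ℝ) ^ 2 / ((a / 2) ^ 2 - h) ^ 2)).toReal :=
        ENNReal.toReal_mono ENNReal.ofReal_ne_top h1
    _ = 2 * (h : ℝ) ^ 2 / ((a / 2) ^ 2 - h) ^ 2 := ENNReal.toReal_ofReal (by positivity)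
    _ ≤ 2048 / c₀ ^ 4 * (h : ℝ) ^ 2 := hbound

include hB hρ₀ hρ1 hBρ hδ0 hδ hh0 hh in
/-- **The bad-event integral**: `∫_{Gᶜ} |F| ≤ (p(1 + 3A₂) + 2A₁√p + 5A₂√p) h√h`, `p = 2048/c₀⁴`
(`|F| ≤ 1 + A₁|x| + A₂(x² + (8/3)h)`, `P(Gᶜ) ≤ p h²`, Cauchy–Schwarz for `∫_{Gᶜ}|x|`, `∫_{Gᶜ} x²`).
[folklore] -/
theorem setIntegral_bad_le (hmeas : Measurable fun ω ↦ starDeriv (slidHull (stepDriver ω) B₀ h)) :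
    ∫ ω in (goodEvent δ₀ ρ₀ h)ᶜ, |stepErrFn B₀ h ω| ∂preWienerMeasure ≤
      (2048 / (δ₀ * ρ₀ / 4000) ^ 4 * (1 + 3 * stepA2 δ₀ ρ₀) +
        2 * stepA1 δ₀ ρ₀ * Real.sqrt (2048 / (δ₀ * ρ₀ / 4000) ^ 4) +
        5 * stepA2 δ₀ ρ₀ * Real.sqrt (2048 / (δ₀ * ρ₀ / 4000) ^ 4)) * h * Real.sqrt h := by
  haveI := isProbabilityMeasure_preWienerMeasure'
  obtain ⟨hc0, hc1, h4, hh1, hh2, hhs⟩ := step_smallness hB hρ₀ hρ1 hδ0 hδ hh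
  obtain ⟨-, iF⟩ := integrable_stepErrFn (B₀ := B₀) (h := h) hmeas
  obtain ⟨-, ix2, i1, i2, -, -⟩ := integral_stepDriver h
  have hGm := measurableSet_goodEvent δ₀ ρ₀ h
  have hh0' : (0 : ℝ) ≤ h := h.coe_nonneg
  have hA1 : 0 ≤ stepA1 δ₀ ρ₀ := by rw [stepA1]; positivity
  have hA2 : 0 ≤ stepA2 δ₀ ρ₀ := by rw [stepA2]; positivity
  set p : ℝ := 2048 / (δ₀ * ρ₀ / 4000) ^ 4 with hp
  have hp0 : 0 ≤ p := by positivity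
  have hPbad : preWienerMeasure.real (goodEvent δ₀ ρ₀ h)ᶜ ≤ p * (h : ℝ) ^ 2 := measureReal_bad_le hB hρ₀ hρ1 hδ0 hδ hh0 hh
  have hsqP : Real.sqrt (preWienerMeasure.real (goodEvent δ₀ ρ₀ h)ᶜ) ≤ Real.sqrt p * h := by
    rw [← Real.sqrt_sq hh0', ← Real.sqrt_mul hp0]; exact Real.sqrt_le_sqrt hPbad
  -- the dominating function on the bad event
  have i1a : Integrable (fun ω ↦ stepA1 δ₀ ρ₀ * |stepDriver ω h|) preWienerMeasure := i1.abs.const_mul _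
  have i2c : Integrable (fun ω ↦ stepDriver ω h ^ 2 + 8 / 3 * h) preWienerMeasure := i2.add (integrable_const _)
  have i2a : Integrable (fun ω ↦ stepA2 δ₀ ρ₀ * (stepDriver ω h ^ 2 + 8 / 3 * h)) preWienerMeasure := i2c.const_mul _
  have i01 : Integrable (fun ω ↦ 1 + stepA1 δ₀ ρ₀ * |stepDriver ω h|) preWienerMeasure := (integrable_const _).add i1a
  have ibad : Integrable (fun ω ↦ 1 + stepA1 δ₀ ρ₀ * |stepDriver ω h| + stepA2 δ₀ ρ₀ * (stepDriver ω h ^ 2 + 8 / 3 * h))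
      preWienerMeasure := i01.add i2a
  have hdom : ∫ ω in (goodEvent δ₀ ρ₀ h)ᶜ, |stepErrFn B₀ h ω| ∂preWienerMeasure ≤
      ∫ ω in (goodEvent δ₀ ρ₀ h)ᶜ, (1 + stepA1 δ₀ ρ₀ * |stepDriver ω h| + stepA2 δ₀ ρ₀ * (stepDriver ω h ^ 2 + 8 / 3 * h))
        ∂preWienerMeasure :=
    setIntegral_mono_on iF.abs.integrableOn ibad.integrableOn hGm.compl fun ω _ ↦ abs_stepErrFn_le hB hρ₀ hBρ hδ0 hδ ω
  have hsplit : ∫ ω in (goodEvent δ₀ ρ₀ h)ᶜ, (1 + stepA1 δ₀ ρ₀ * |stepDriver ω h| +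
      stepA2 δ₀ ρ₀ * (stepDriver ω h ^ 2 + 8 / 3 * h)) ∂preWienerMeasure =
      preWienerMeasure.real (goodEvent δ₀ ρ₀ h)ᶜ * (1 + stepA2 δ₀ ρ₀ * (8 / 3 * h)) +
        stepA1 δ₀ ρ₀ * ∫ ω in (goodEvent δ₀ ρ₀ h)ᶜ, |stepDriver ω h| ∂preWienerMeasure +
        stepA2 δ₀ ρ₀ * ∫ ω in (goodEvent δ₀ ρ₀ h)ᶜ, stepDriver ω h ^ 2 ∂preWienerMeasure := by
    rw [integral_add i01.integrableOn i2a.integrableOn, integral_add (integrable_const _).integrableOn i1a.integrableOn,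
      integral_const_mul, integral_const_mul, integral_add i2.integrableOn (integrable_const _).integrableOn,
      setIntegral_const, setIntegral_const]
    simp only [smul_eq_mul]
    ring
  -- Cauchy–Schwarz
  have hCS1 : ∫ ω in (goodEvent δ₀ ρ₀ h)ᶜ, |stepDriver ω h| ∂preWienerMeasure ≤ Real.sqrt p * h * (2 * Real.sqrt h) := by
    have hmem : MemLp (fun ω ↦ |stepDriver ω h|) 2 preWienerMeasure := by
      have : MemLp (fun ω ↦ stepDriver ω h) 2 preWienerMeasure := by
        have h1 : (fun ω ↦ stepDriver ω h) = fun ω ↦ stepSigma * brownian h ω := funext fun ω ↦ stepDriver_apply ω h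
        rw [h1]; exact (memLp_brownian h (by simp)).const_mul _
      exact this.abs
    refine (setIntegral_le_sqrt_mul_sqrt hGm.compl (fun ω ↦ abs_nonneg _) hmem).trans ?_
    have e2 : Real.sqrt (∫ ω, |stepDriver ω h| ^ 2 ∂preWienerMeasure) ≤ 2 * Real.sqrt h := by
      simp_rw [sq_abs]
      rw [ix2, Real.sqrt_le_left (by positivity)]
      have := Real.sq_sqrt hh0'
      nlinarith
    exact mul_le_mul hsqP e2 (Real.sqrt_nonneg _) (by positivity)
  have hCS2 : ∫ ω in (goodEvent δ₀ ρ₀ h)ᶜ, stepDriver ω h ^ 2 ∂preWienerMeasure ≤ Real.sqrt p * h * (5 * h) := by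
    have hmem : MemLp (fun ω ↦ stepDriver ω h ^ 2) 2 preWienerMeasure := by
      have h1 := memLp_two_brownian_sub_sq 0 h
      simp only [brownian_zero, sub_zero] at h1
      have : (fun ω ↦ stepDriver ω h ^ 2) = fun ω ↦ stepSigma ^ 2 * brownian h ω ^ 2 := by
        funext ω; rw [stepDriver_apply, mul_pow]
      rw [this]; exact h1.const_mul _
    refine (setIntegral_le_sqrt_mul_sqrt hGm.compl (fun ω ↦ sq_nonneg _) hmem).trans ?_
    have e2 : Real.sqrt (∫ ω, (stepDriver ω h ^ 2) ^ 2 ∂preWienerMeasure) ≤ 5 * h := by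
      have : (fun ω ↦ (stepDriver ω h ^ 2) ^ 2) = fun ω ↦ stepSigma ^ 4 * brownian h ω ^ 4 := by
        funext ω; rw [stepDriver_apply]; ring
      rw [this, integral_const_mul, integral_brownian_pow_four, Real.sqrt_le_left (by positivity)]
      have hσ4 : stepSigma ^ 4 = (8 / 3) ^ 2 := by rw [show (4:ℕ) = 2 * 2 by norm_num, pow_mul, stepSigma_sq]
      rw [hσ4]
      nlinarith [sq_nonneg (h : ℝ)]
    exact mul_le_mul hsqP e2 (Real.sqrt_nonneg _) (by positivity)
  -- assemble
  have t1 : preWienerMeasure.real (goodEvent δ₀ ρ₀ h)ᶜ * (1 + stepA2 δ₀ ρ₀ * (8 / 3 * h)) ≤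
      p * (1 + 3 * stepA2 δ₀ ρ₀) * h * Real.sqrt h := by
    have f1 : 1 + stepA2 δ₀ ρ₀ * (8 / 3 * h) ≤ 1 + 3 * stepA2 δ₀ ρ₀ := by nlinarith [mul_nonneg hA2 hh0']
    have f2 := mul_le_mul hPbad f1 (by positivity) (by positivity)
    have f3 := mul_le_mul_of_nonneg_left hh2 (by positivity : 0 ≤ p * (1 + 3 * stepA2 δ₀ ρ₀))
    nlinarith [f2, f3]
  have t2 : stepA1 δ₀ ρ₀ * ∫ ω in (goodEvent δ₀ ρ₀ h)ᶜ, |stepDriver ω h| ∂preWienerMeasure ≤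
      2 * stepA1 δ₀ ρ₀ * Real.sqrt p * h * Real.sqrt h := by
    have := mul_le_mul_of_nonneg_left hCS1 hA1; nlinarith [this]
  have t3 : stepA2 δ₀ ρ₀ * ∫ ω in (goodEvent δ₀ ρ₀ h)ᶜ, stepDriver ω h ^ 2 ∂preWienerMeasure ≤
      5 * stepA2 δ₀ ρ₀ * Real.sqrt p * h * Real.sqrt h := by
    have f1 := mul_le_mul_of_nonneg_left hCS2 hA2
    have f2 := mul_le_mul_of_nonneg_left hhs (by positivity : 0 ≤ 5 * stepA2 δ₀ ρ₀ * Real.sqrt p * h)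
    nlinarith [f1, f2]
  calc _ ≤ _ := hdom
    _ = _ := hsplit
    _ ≤ p * (1 + 3 * stepA2 δ₀ ρ₀) * h * Real.sqrt h + 2 * stepA1 δ₀ ρ₀ * Real.sqrt p * h * Real.sqrt h +
        5 * stepA2 δ₀ ρ₀ * Real.sqrt p * h * Real.sqrt h := add_le_add (add_le_add t1 t2) t3
    _ = _ := by ring

include hB hρ₀ hρ1 hBρ hδ0 hδ hh0 hh in
/-- **[LSW] Prop. 5.2/5.3, one step at `κ = 8/3`**: for a `*`-hull `B₀` in the controlled class
(`δ₀ ≤ Φ'_{B₀}(0)`, `B₀` missing `ball 0 (8ρ₀)`, `ρ₀ ≤ 1`) and `h ≤ c₀²/32`, `c₀ = δ₀ρ₀/4000`: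

  `|E[Φ'_{B'}(0)^{5/8}] - Φ'_{B₀}(0)^{5/8}| ≤ stepC δ₀ ρ₀ · h √h`,   `B' = slidHull (√(8/3) B) B₀ h`

(the mean of the model vanishes; good and bad events as above).
[cite: LawlerSchrammWerner2003Restriction, Prop. 5.2 and Prop. 5.3] -/
theorem abs_integral_rpow_sub_le (hmeas : Measurable fun ω ↦ starDeriv (slidHull (stepDriver ω) B₀ h)) :
    |∫ ω, starDeriv (slidHull (stepDriver ω) B₀ h) ^ (5 / 8 : ℝ) ∂preWienerMeasure - starDeriv B₀ ^ (5 / 8 : ℝ)| ≤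
      stepC δ₀ ρ₀ * h * Real.sqrt h := by
  haveI := isProbabilityMeasure_preWienerMeasure'
  obtain ⟨hd0, -, -⟩ := starDeriv_spec hB
  obtain ⟨iY', iF⟩ := integrable_stepErrFn (B₀ := B₀) (h := h) hmeas
  obtain ⟨hM0, iM⟩ := integral_stepModel_eq_zero hd0 (starJet2 B₀) (starJet3 B₀) h
  have hGm := measurableSet_goodEvent δ₀ ρ₀ h
  -- `∫ Y' - Y = ∫ F` (the model has mean zero)
  have iY'Y : Integrable (fun ω ↦ starDeriv (slidHull (stepDriver ω) B₀ h) ^ (5 / 8 : ℝ) - starDeriv B₀ ^ (5 / 8 : ℝ))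
      preWienerMeasure := iY'.sub (integrable_const _)
  have hdec : ∫ ω, starDeriv (slidHull (stepDriver ω) B₀ h) ^ (5 / 8 : ℝ) ∂preWienerMeasure - starDeriv B₀ ^ (5 / 8 : ℝ) =
      ∫ ω, stepErrFn B₀ h ω ∂preWienerMeasure := by
    have hF : stepErrFn B₀ h = fun ω ↦ (starDeriv (slidHull (stepDriver ω) B₀ h) ^ (5 / 8 : ℝ) - starDeriv B₀ ^ (5 / 8 : ℝ)) -
        stepModel (starDeriv B₀) (starJet2 B₀) (starJet3 B₀) h (stepDriver ω h) := rfl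
    rw [hF, integral_sub iY'Y iM, integral_sub iY' (integrable_const _), integral_const, hM0]
    simp
  rw [hdec]
  have h1 : |∫ ω, stepErrFn B₀ h ω ∂preWienerMeasure| ≤ ∫ ω, |stepErrFn B₀ h ω| ∂preWienerMeasure :=
    abs_integral_le_integral_abs
  rw [← integral_add_compl hGm iF.abs] at h1
  have h2 := setIntegral_good_le hB hρ₀ hρ1 hBρ hδ0 hδ hh0 hh hmeas
  have h3 := setIntegral_bad_le hB hρ₀ hρ1 hBρ hδ0 hδ hh0 hh hmeas
  have h4 : 25 * stepKcleanOf δ₀ (stepK δ₀ ρ₀) * h * Real.sqrt h +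
      (2048 / (δ₀ * ρ₀ / 4000) ^ 4 * (1 + 3 * stepA2 δ₀ ρ₀) +
        2 * stepA1 δ₀ ρ₀ * Real.sqrt (2048 / (δ₀ * ρ₀ / 4000) ^ 4) +
        5 * stepA2 δ₀ ρ₀ * Real.sqrt (2048 / (δ₀ * ρ₀ / 4000) ^ 4)) * h * Real.sqrt h = stepC δ₀ ρ₀ * h * Real.sqrt h := by
    rw [stepC]; ring
  linarith

end Estimates

/-! ### The estimate for any measurable version of `Y'` agreeing with it on the good event -/

section General

variable {B₀ : Set ℂ} {ρ₀ δ₀ : ℝ} {h : ℝ≥0}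
variable (hB : IsStarHull B₀) (hρ₀ : 0 < ρ₀) (hρ1 : ρ₀ ≤ 1) (hBρ : Disjoint (ball (0 : ℂ) (8 * ρ₀)) B₀)
  (hδ0 : 0 < δ₀) (hδ : δ₀ ≤ starDeriv B₀) (hh0 : 0 < h) (hh : (h : ℝ) ≤ (δ₀ * ρ₀ / 4000) ^ 2 / 32)

include hB hρ₀ hρ1 hδ0 hδ hh in
/-- The good-event integral for any integrable `F'` obeying the good-event bound. [folklore] -/
theorem setIntegral_good_le' {F' : (ℝ≥0 → ℝ) → ℝ} (iF : Integrable F' preWienerMeasure)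
    (hgood : ∀ ω ∈ goodEvent δ₀ ρ₀ h, |F' ω| ≤ stepKcleanOf δ₀ (stepK δ₀ ρ₀) *
        (h * stepSize (stepSigma * runSup h ω) h + h ^ 2 + |stepDriver ω h| ^ 3 + h * |stepDriver ω h|)) :
    ∫ ω in goodEvent δ₀ ρ₀ h, |F' ω| ∂preWienerMeasure ≤ 25 * stepKcleanOf δ₀ (stepK δ₀ ρ₀) * h * Real.sqrt h := by
  haveI := isProbabilityMeasure_preWienerMeasure'
  obtain ⟨hc0, hc1, h4, hh1, hh2, hhs⟩ := step_smallness hB hρ₀ hρ1 hδ0 hδ hh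
  obtain ⟨hd0, hd1, -⟩ := starDeriv_spec hB
  obtain ⟨-, -, i1, -, i3, -⟩ := integral_stepDriver h
  set Kc := stepKcleanOf δ₀ (stepK δ₀ ρ₀) with hKc
  have hKc0 : 0 ≤ Kc := by
    rw [hKc, stepKcleanOf]; have := (stepK_spec hδ0 (hδ.trans hd1) hρ₀ hρ1).1; positivity
  have hh0' : (0 : ℝ) ≤ h := h.coe_nonneg
  have iη : Integrable (fun ω ↦ stepSize (stepSigma * runSup h ω) h) preWienerMeasure := by
    have : (fun ω ↦ stepSize (stepSigma * runSup h ω) h) = fun ω ↦ stepSigma * runSup h ω + 4 * Real.sqrt h := by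
      funext ω; rw [stepSize]
    rw [this]; exact ((integrable_runSup h).const_mul _).add (integrable_const _)
  have iA : Integrable (fun ω ↦ h * stepSize (stepSigma * runSup h ω) h + h ^ 2) preWienerMeasure :=
    (iη.const_mul _).add (integrable_const _)
  have iAB : Integrable (fun ω ↦ h * stepSize (stepSigma * runSup h ω) h + h ^ 2 + |stepDriver ω h| ^ 3) preWienerMeasure :=
    iA.add i3
  have iD : Integrable (fun ω ↦ h * |stepDriver ω h|) preWienerMeasure := i1.abs.const_mul _
  have iABD : Integrable (fun ω ↦ h * stepSize (stepSigma * runSup h ω) h + h ^ 2 + |stepDriver ω h| ^ 3 + h * |stepDriver ω h|)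
      preWienerMeasure := iAB.add iD
  have ibound : Integrable (fun ω ↦ Kc * (h * stepSize (stepSigma * runSup h ω) h + h ^ 2 + |stepDriver ω h| ^ 3 +
      h * |stepDriver ω h|)) preWienerMeasure := iABD.const_mul Kc
  have hpos : ∀ ω, 0 ≤ Kc * (h * stepSize (stepSigma * runSup h ω) h + h ^ 2 + |stepDriver ω h| ^ 3 + h * |stepDriver ω h|) := by
    intro ω
    have : 0 ≤ stepSize (stepSigma * runSup h ω) h := by
      rw [stepSize]; have := runSup_nonneg h ω; have := stepSigma_pos; positivity
    positivity
  have e1 : ∫ ω, stepSize (stepSigma * runSup h ω) h ∂preWienerMeasure ≤ 8 * Real.sqrt h := by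
    have : (fun ω ↦ stepSize (stepSigma * runSup h ω) h) = fun ω ↦ stepSigma * runSup h ω + 4 * Real.sqrt h := by
      funext ω; rw [stepSize]
    rw [this, integral_add ((integrable_runSup h).const_mul _) (integrable_const _), integral_const_mul, integral_const]
    simp only [probReal_univ, smul_eq_mul, one_mul]
    have h1 := integral_runSup_le h
    have h2 := mul_le_mul_of_nonneg_left h1 stepSigma_pos.le
    nlinarith [stepSigma_le_two, Real.sqrt_nonneg (h : ℝ)]
  have e2 : ∫ ω, |stepDriver ω h| ^ 3 ∂preWienerMeasure ≤ 14 * h * Real.sqrt h := by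
    have : (fun ω ↦ |stepDriver ω h| ^ 3) = fun ω ↦ stepSigma ^ 3 * |brownian h ω| ^ 3 := by
      funext ω; rw [stepDriver_apply, abs_mul, mul_pow, abs_of_pos stepSigma_pos]
    rw [this, integral_const_mul]
    have h3 := integral_abs_brownian_pow_three_le h
    have hσ3 : stepSigma ^ 3 ≤ 8 := by
      have := pow_le_pow_left₀ stepSigma_pos.le stepSigma_le_two 3; norm_num at this; exact this
    have hs3 : Real.sqrt 3 ≤ 7 / 4 := by rw [Real.sqrt_le_left (by norm_num)]; norm_num
    have hh32 : (h : ℝ) ^ (3 / 2 : ℝ) = h * Real.sqrt h := by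
      rw [show (3 / 2 : ℝ) = 1 + 1 / 2 by norm_num, Real.rpow_add' hh0' (by norm_num), Real.rpow_one, Real.sqrt_eq_rpow]
    rw [hh32] at h3
    have hI0 : 0 ≤ ∫ ω, |brownian h ω| ^ 3 ∂preWienerMeasure := integral_nonneg fun ω ↦ by positivity
    have hm : 0 ≤ (h : ℝ) * Real.sqrt h := by positivity
    calc stepSigma ^ 3 * ∫ ω, |brownian h ω| ^ 3 ∂preWienerMeasure ≤ 8 * (Real.sqrt 3 * (h * Real.sqrt h)) :=
          mul_le_mul hσ3 h3 hI0 (by norm_num)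
      _ ≤ 14 * h * Real.sqrt h := by nlinarith
  have e3 : ∫ ω, |stepDriver ω h| ∂preWienerMeasure ≤ 2 * Real.sqrt h := by
    have : (fun ω ↦ |stepDriver ω h|) = fun ω ↦ stepSigma * |brownian h ω| := by
      funext ω; rw [stepDriver_apply, abs_mul, abs_of_pos stepSigma_pos]
    rw [this, integral_const_mul]
    have h1 := integral_abs_brownian_le h
    have h2 := mul_le_mul_of_nonneg_left h1 stepSigma_pos.le
    nlinarith [stepSigma_le_two, Real.sqrt_nonneg (h : ℝ)]
  have hint : ∫ ω, Kc * (h * stepSize (stepSigma * runSup h ω) h + h ^ 2 + |stepDriver ω h| ^ 3 + h * |stepDriver ω h|)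
      ∂preWienerMeasure ≤ 25 * Kc * h * Real.sqrt h := by
    rw [integral_const_mul, integral_add iAB iD, integral_add iA i3, integral_add (iη.const_mul _) (integrable_const _),
      integral_const_mul, integral_const_mul, integral_const]
    simp only [probReal_univ, smul_eq_mul, one_mul]
    have f1 := mul_le_mul_of_nonneg_left e1 hh0'
    have f3 := mul_le_mul_of_nonneg_left e3 hh0'
    have hsum : (h : ℝ) * ∫ ω, stepSize (stepSigma * runSup h ω) h ∂preWienerMeasure + (h : ℝ) ^ 2 +
        ∫ ω, |stepDriver ω h| ^ 3 ∂preWienerMeasure + (h : ℝ) * ∫ ω, |stepDriver ω h| ∂preWienerMeasure ≤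
        25 * h * Real.sqrt h := by nlinarith
    have := mul_le_mul_of_nonneg_left hsum hKc0
    nlinarith [this]
  calc ∫ ω in goodEvent δ₀ ρ₀ h, |F' ω| ∂preWienerMeasure
      ≤ ∫ ω in goodEvent δ₀ ρ₀ h, Kc * (h * stepSize (stepSigma * runSup h ω) h + h ^ 2 + |stepDriver ω h| ^ 3 +
          h * |stepDriver ω h|) ∂preWienerMeasure :=
        setIntegral_mono_on iF.abs.integrableOn ibound.integrableOn (measurableSet_goodEvent δ₀ ρ₀ h) fun ω hω ↦ hgood ω hω
    _ ≤ ∫ ω, Kc * (h * stepSize (stepSigma * runSup h ω) h + h ^ 2 + |stepDriver ω h| ^ 3 + h * |stepDriver ω h|)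
          ∂preWienerMeasure := setIntegral_le_integral ibound (Eventually.of_forall hpos)
    _ ≤ 25 * Kc * h * Real.sqrt h := hint

include hB hρ₀ hρ1 hδ0 hδ hh0 hh in
/-- The bad-event integral for any integrable `F'` obeying `|F'| ≤ 1 + A₁|x| + A₂(x² + (8/3)h)`.
[folklore] -/
theorem setIntegral_bad_le' {F' : (ℝ≥0 → ℝ) → ℝ} (iF : Integrable F' preWienerMeasure)
    (hbad : ∀ ω, |F' ω| ≤ 1 + stepA1 δ₀ ρ₀ * |stepDriver ω h| + stepA2 δ₀ ρ₀ * (stepDriver ω h ^ 2 + 8 / 3 * h)) :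
    ∫ ω in (goodEvent δ₀ ρ₀ h)ᶜ, |F' ω| ∂preWienerMeasure ≤
      (2048 / (δ₀ * ρ₀ / 4000) ^ 4 * (1 + 3 * stepA2 δ₀ ρ₀) +
        2 * stepA1 δ₀ ρ₀ * Real.sqrt (2048 / (δ₀ * ρ₀ / 4000) ^ 4) +
        5 * stepA2 δ₀ ρ₀ * Real.sqrt (2048 / (δ₀ * ρ₀ / 4000) ^ 4)) * h * Real.sqrt h := by
  haveI := isProbabilityMeasure_preWienerMeasure'
  obtain ⟨hc0, hc1, h4, hh1, hh2, hhs⟩ := step_smallness hB hρ₀ hρ1 hδ0 hδ hh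
  obtain ⟨-, ix2, i1, i2, -, -⟩ := integral_stepDriver h
  have hGm := measurableSet_goodEvent δ₀ ρ₀ h
  have hh0' : (0 : ℝ) ≤ h := h.coe_nonneg
  have hA1 : 0 ≤ stepA1 δ₀ ρ₀ := by rw [stepA1]; positivity
  have hA2 : 0 ≤ stepA2 δ₀ ρ₀ := by rw [stepA2]; positivity
  set p : ℝ := 2048 / (δ₀ * ρ₀ / 4000) ^ 4 with hp
  have hp0 : 0 ≤ p := by positivity
  have hPbad : preWienerMeasure.real (goodEvent δ₀ ρ₀ h)ᶜ ≤ p * (h : ℝ) ^ 2 := measureReal_bad_le hB hρ₀ hρ1 hδ0 hδ hh0 hh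
  have hsqP : Real.sqrt (preWienerMeasure.real (goodEvent δ₀ ρ₀ h)ᶜ) ≤ Real.sqrt p * h := by
    rw [← Real.sqrt_sq hh0', ← Real.sqrt_mul hp0]; exact Real.sqrt_le_sqrt hPbad
  have i1a : Integrable (fun ω ↦ stepA1 δ₀ ρ₀ * |stepDriver ω h|) preWienerMeasure := i1.abs.const_mul _
  have i2c : Integrable (fun ω ↦ stepDriver ω h ^ 2 + 8 / 3 * h) preWienerMeasure := i2.add (integrable_const _)
  have i2a : Integrable (fun ω ↦ stepA2 δ₀ ρ₀ * (stepDriver ω h ^ 2 + 8 / 3 * h)) preWienerMeasure := i2c.const_mul _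
  have i01 : Integrable (fun ω ↦ 1 + stepA1 δ₀ ρ₀ * |stepDriver ω h|) preWienerMeasure := (integrable_const _).add i1a
  have ibad : Integrable (fun ω ↦ 1 + stepA1 δ₀ ρ₀ * |stepDriver ω h| + stepA2 δ₀ ρ₀ * (stepDriver ω h ^ 2 + 8 / 3 * h))
      preWienerMeasure := i01.add i2a
  have hdom : ∫ ω in (goodEvent δ₀ ρ₀ h)ᶜ, |F' ω| ∂preWienerMeasure ≤
      ∫ ω in (goodEvent δ₀ ρ₀ h)ᶜ, (1 + stepA1 δ₀ ρ₀ * |stepDriver ω h| + stepA2 δ₀ ρ₀ * (stepDriver ω h ^ 2 + 8 / 3 * h))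
        ∂preWienerMeasure :=
    setIntegral_mono_on iF.abs.integrableOn ibad.integrableOn hGm.compl fun ω _ ↦ hbad ω
  have hsplit : ∫ ω in (goodEvent δ₀ ρ₀ h)ᶜ, (1 + stepA1 δ₀ ρ₀ * |stepDriver ω h| +
      stepA2 δ₀ ρ₀ * (stepDriver ω h ^ 2 + 8 / 3 * h)) ∂preWienerMeasure =
      preWienerMeasure.real (goodEvent δ₀ ρ₀ h)ᶜ * (1 + stepA2 δ₀ ρ₀ * (8 / 3 * h)) +
        stepA1 δ₀ ρ₀ * ∫ ω in (goodEvent δ₀ ρ₀ h)ᶜ, |stepDriver ω h| ∂preWienerMeasure +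
        stepA2 δ₀ ρ₀ * ∫ ω in (goodEvent δ₀ ρ₀ h)ᶜ, stepDriver ω h ^ 2 ∂preWienerMeasure := by
    rw [integral_add i01.integrableOn i2a.integrableOn, integral_add (integrable_const _).integrableOn i1a.integrableOn,
      integral_const_mul, integral_const_mul, integral_add i2.integrableOn (integrable_const _).integrableOn,
      setIntegral_const, setIntegral_const]
    simp only [smul_eq_mul]
    ring
  have hCS1 : ∫ ω in (goodEvent δ₀ ρ₀ h)ᶜ, |stepDriver ω h| ∂preWienerMeasure ≤ Real.sqrt p * h * (2 * Real.sqrt h) := by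
    have hmem : MemLp (fun ω ↦ |stepDriver ω h|) 2 preWienerMeasure := by
      have : MemLp (fun ω ↦ stepDriver ω h) 2 preWienerMeasure := by
        have h1 : (fun ω ↦ stepDriver ω h) = fun ω ↦ stepSigma * brownian h ω := funext fun ω ↦ stepDriver_apply ω h
        rw [h1]; exact (memLp_brownian h (by simp)).const_mul _
      exact this.abs
    refine (setIntegral_le_sqrt_mul_sqrt hGm.compl (fun ω ↦ abs_nonneg _) hmem).trans ?_
    have e2 : Real.sqrt (∫ ω, |stepDriver ω h| ^ 2 ∂preWienerMeasure) ≤ 2 * Real.sqrt h := by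
      simp_rw [sq_abs]
      rw [ix2, Real.sqrt_le_left (by positivity)]
      have := Real.sq_sqrt hh0'
      nlinarith
    exact mul_le_mul hsqP e2 (Real.sqrt_nonneg _) (by positivity)
  have hCS2 : ∫ ω in (goodEvent δ₀ ρ₀ h)ᶜ, stepDriver ω h ^ 2 ∂preWienerMeasure ≤ Real.sqrt p * h * (5 * h) := by
    have hmem : MemLp (fun ω ↦ stepDriver ω h ^ 2) 2 preWienerMeasure := by
      have h1 := memLp_two_brownian_sub_sq 0 h
      simp only [brownian_zero, sub_zero] at h1
      have : (fun ω ↦ stepDriver ω h ^ 2) = fun ω ↦ stepSigma ^ 2 * brownian h ω ^ 2 := by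
        funext ω; rw [stepDriver_apply, mul_pow]
      rw [this]; exact h1.const_mul _
    refine (setIntegral_le_sqrt_mul_sqrt hGm.compl (fun ω ↦ sq_nonneg _) hmem).trans ?_
    have e2 : Real.sqrt (∫ ω, (stepDriver ω h ^ 2) ^ 2 ∂preWienerMeasure) ≤ 5 * h := by
      have : (fun ω ↦ (stepDriver ω h ^ 2) ^ 2) = fun ω ↦ stepSigma ^ 4 * brownian h ω ^ 4 := by
        funext ω; rw [stepDriver_apply]; ring
      rw [this, integral_const_mul, integral_brownian_pow_four, Real.sqrt_le_left (by positivity)]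
      have hσ4 : stepSigma ^ 4 = (8 / 3) ^ 2 := by rw [show (4:ℕ) = 2 * 2 by norm_num, pow_mul, stepSigma_sq]
      rw [hσ4]
      nlinarith [sq_nonneg (h : ℝ)]
    exact mul_le_mul hsqP e2 (Real.sqrt_nonneg _) (by positivity)
  have t1 : preWienerMeasure.real (goodEvent δ₀ ρ₀ h)ᶜ * (1 + stepA2 δ₀ ρ₀ * (8 / 3 * h)) ≤
      p * (1 + 3 * stepA2 δ₀ ρ₀) * h * Real.sqrt h := by
    have f1 : 1 + stepA2 δ₀ ρ₀ * (8 / 3 * h) ≤ 1 + 3 * stepA2 δ₀ ρ₀ := by nlinarith [mul_nonneg hA2 hh0']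
    have f2 := mul_le_mul hPbad f1 (by positivity) (by positivity)
    have f3 := mul_le_mul_of_nonneg_left hh2 (by positivity : 0 ≤ p * (1 + 3 * stepA2 δ₀ ρ₀))
    nlinarith [f2, f3]
  have t2 : stepA1 δ₀ ρ₀ * ∫ ω in (goodEvent δ₀ ρ₀ h)ᶜ, |stepDriver ω h| ∂preWienerMeasure ≤
      2 * stepA1 δ₀ ρ₀ * Real.sqrt p * h * Real.sqrt h := by
    have := mul_le_mul_of_nonneg_left hCS1 hA1; nlinarith [this]
  have t3 : stepA2 δ₀ ρ₀ * ∫ ω in (goodEvent δ₀ ρ₀ h)ᶜ, stepDriver ω h ^ 2 ∂preWienerMeasure ≤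
      5 * stepA2 δ₀ ρ₀ * Real.sqrt p * h * Real.sqrt h := by
    have f1 := mul_le_mul_of_nonneg_left hCS2 hA2
    have f2 := mul_le_mul_of_nonneg_left hhs (by positivity : 0 ≤ 5 * stepA2 δ₀ ρ₀ * Real.sqrt p * h)
    nlinarith [f1, f2]
  calc _ ≤ _ := hdom
    _ = _ := hsplit
    _ ≤ p * (1 + 3 * stepA2 δ₀ ρ₀) * h * Real.sqrt h + 2 * stepA1 δ₀ ρ₀ * Real.sqrt p * h * Real.sqrt h +
        5 * stepA2 δ₀ ρ₀ * Real.sqrt p * h * Real.sqrt h := add_le_add (add_le_add t1 t2) t3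
    _ = _ := by ring

include hB hρ₀ hρ1 hBρ hδ0 hδ hh0 hh in
/-- **[LSW] Prop. 5.2/5.3, one step at `κ = 8/3`, for any measurable version of `Y'`**: if
`Z : Ω → [0, 1]` is measurable and agrees with `Φ'_{B'}(0)^{5/8}` on the good event
`{σ · sup_{[0,h]} |B| ≤ c₀}` (`B' = slidHull (√(8/3) B) B₀ h`), then
`|E[Z] - Φ'_{B₀}(0)^{5/8}| ≤ stepC δ₀ ρ₀ · h √h`. (On the good event the slid hull is the true hull
of the next time step and `Z` is the next value of the candidate martingale; off it, only `Z ∈ [0,1]`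
is used.) [cite: LawlerSchrammWerner2003Restriction, Prop. 5.2 and Prop. 5.3] -/
theorem abs_integral_sub_le_of_eqOn_good {Z : (ℝ≥0 → ℝ) → ℝ} (hZm : Measurable Z) (hZ01 : ∀ ω, Z ω ∈ Icc (0 : ℝ) 1)
    (hZeq : ∀ ω ∈ goodEvent δ₀ ρ₀ h, Z ω = starDeriv (slidHull (stepDriver ω) B₀ h) ^ (5 / 8 : ℝ)) :
    |∫ ω, Z ω ∂preWienerMeasure - starDeriv B₀ ^ (5 / 8 : ℝ)| ≤ stepC δ₀ ρ₀ * h * Real.sqrt h := by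
  haveI := isProbabilityMeasure_preWienerMeasure'
  obtain ⟨hd0, hd1, -⟩ := starDeriv_spec hB
  obtain ⟨hM0, iM⟩ := integral_stepModel_eq_zero hd0 (starJet2 B₀) (starJet3 B₀) h
  have hGm := measurableSet_goodEvent δ₀ ρ₀ h
  have iZ : Integrable Z preWienerMeasure :=
    (integrable_const (1 : ℝ)).mono' hZm.aestronglyMeasurable (Eventually.of_forall fun ω ↦ by
      rw [Real.norm_eq_abs, abs_of_nonneg (hZ01 ω).1]; exact (hZ01 ω).2)
  set F' : (ℝ≥0 → ℝ) → ℝ := fun ω ↦ (Z ω - starDeriv B₀ ^ (5 / 8 : ℝ)) -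
    stepModel (starDeriv B₀) (starJet2 B₀) (starJet3 B₀) h (stepDriver ω h) with hF'
  have iZY : Integrable (fun ω ↦ Z ω - starDeriv B₀ ^ (5 / 8 : ℝ)) preWienerMeasure := iZ.sub (integrable_const _)
  have iF : Integrable F' preWienerMeasure := iZY.sub iM
  have hdec : ∫ ω, Z ω ∂preWienerMeasure - starDeriv B₀ ^ (5 / 8 : ℝ) = ∫ ω, F' ω ∂preWienerMeasure := by
    rw [hF', integral_sub iZY iM, integral_sub iZ (integrable_const _), integral_const, hM0]
    simp
  rw [hdec]
  -- pointwise bounds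
  have hgood : ∀ ω ∈ goodEvent δ₀ ρ₀ h, |F' ω| ≤ stepKcleanOf δ₀ (stepK δ₀ ρ₀) *
      (h * stepSize (stepSigma * runSup h ω) h + h ^ 2 + |stepDriver ω h| ^ 3 + h * |stepDriver ω h|) := fun ω hω ↦ by
    have : F' ω = stepErrFn B₀ h ω := by
      show (Z ω - starDeriv B₀ ^ (5 / 8 : ℝ)) - _ = _
      rw [stepErrFn, hZeq ω hω]
    rw [this]; exact abs_stepErrFn_le_of_good hB hρ₀ hρ1 hBρ hδ0 hδ hh0 hh hω
  have hbad : ∀ ω, |F' ω| ≤ 1 + stepA1 δ₀ ρ₀ * |stepDriver ω h| + stepA2 δ₀ ρ₀ * (stepDriver ω h ^ 2 + 8 / 3 * h) := by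
    intro ω
    have h1 := abs_sub (Z ω - starDeriv B₀ ^ (5 / 8 : ℝ)) (stepModel (starDeriv B₀) (starJet2 B₀) (starJet3 B₀) h (stepDriver ω h))
    have h2 : |Z ω - starDeriv B₀ ^ (5 / 8 : ℝ)| ≤ 1 := by
      have e1 : starDeriv B₀ ^ (5 / 8 : ℝ) ≤ 1 := Real.rpow_le_one hd0.le hd1 (by norm_num)
      have e3 : 0 ≤ starDeriv B₀ ^ (5 / 8 : ℝ) := Real.rpow_nonneg hd0.le _
      rw [abs_le]; constructor <;> linarith [(hZ01 ω).1, (hZ01 ω).2]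
    have h3 := abs_stepModel_le hB hρ₀ hBρ hδ0 hδ (h := h) (stepDriver ω h)
    have : |F' ω| = |(Z ω - starDeriv B₀ ^ (5 / 8 : ℝ)) - stepModel (starDeriv B₀) (starJet2 B₀) (starJet3 B₀) h (stepDriver ω h)| := rfl
    linarith
  have h1 : |∫ ω, F' ω ∂preWienerMeasure| ≤ ∫ ω, |F' ω| ∂preWienerMeasure := abs_integral_le_integral_abs
  rw [← integral_add_compl hGm iF.abs] at h1
  have h2 := setIntegral_good_le' hB hρ₀ hρ1 hδ0 hδ hh iF hgood
  have h3 := setIntegral_bad_le' hB hρ₀ hρ1 hδ0 hδ hh0 hh iF hbad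
  have h4 : 25 * stepKcleanOf δ₀ (stepK δ₀ ρ₀) * h * Real.sqrt h +
      (2048 / (δ₀ * ρ₀ / 4000) ^ 4 * (1 + 3 * stepA2 δ₀ ρ₀) +
        2 * stepA1 δ₀ ρ₀ * Real.sqrt (2048 / (δ₀ * ρ₀ / 4000) ^ 4) +
        5 * stepA2 δ₀ ρ₀ * Real.sqrt (2048 / (δ₀ * ρ₀ / 4000) ^ 4)) * h * Real.sqrt h = stepC δ₀ ρ₀ * h * Real.sqrt h := by
    rw [stepC]; ring
  linarith

end General

end Literature.Probability.RandomPlanarGeometry
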